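import Literature.NumberTheory.LFunctions.KMVMomentsToHalfEdgePB
import HarnessLib

/-!
# Mollified moments ⇒ the ½-proportion edge at prime level, from the two KMV displays AT `Q = 1` FOR ONE PROFILE
# (pointwise twins of `KMVMomentsToHalfEdge` §5 and `KMVMomentsToHalfEdgePB` §7)

Topic `Literature/NumberTheory/LFunctions`. PROOFS only — no definition, no named fact. The tree's conversion chain
`KMV2000.goodMass_lower_of_momentAsymptotics` → `CentralValueFamilyHalfEdge.primeLevelFamilyTwo_EStarFam_of_momentAsymptotics_pb`
takes the WINDOW predicate `KMV2000.MomentAsymptotics Δlo Δhi T₁ T₂` (both displays, every admissible `P`, EVERY even-or-odd `Q`) but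
USES it once, at `Q = 1`, for the one profile `P` and the one length `Δ` under discussion
(`hMA P 1 hPadm isEvenOrOdd_one Δ hlo hhi`). This file records the same two theorems with exactly that as the hypothesis:
the two KMV displays [KowalskiMichelVanderKam2000, §6 p. 19, Thm. 6.1 (32)] at `Q = 1` for the given `P`, `Δ`, with main terms
`lin + t₁`, `second + t₂` (`t₁, t₂ ∈ ℝ`), eventually in the prime level. Proofs = the originals verbatim after that first line.
Use: a crux / route that states the moment asymptotics at `Q = 1` only (the value every consumer in the tree uses) feeds these
twins directly. Nothing here is a claim about when the displays hold beyond the diagonal (open at an individual level, famE-02), nor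
about Landau–Siegel zeros.

## References
* [KowalskiMichelVanderKam2000] E. Kowalski, P. Michel, J. VanderKam, J. reine angew. Math. 526 (2000), §6 p. 19, Thm. 6.1 (32).
* [IwaniecConversations2006] H. Iwaniec, LNM 1891 (2006), §7 (7.5) and p. 97.
* [KowalskiMichel2000] E. Kowalski, P. Michel, Acta Arith. 94 (2000), §2.3 p. 310.
* Tree: `KMVMomentsToHalfEdge`, `KMVMomentsToHalfEdgePB` (the window versions, of which these are the pointwise cores).
-/

noncomputable section

open scoped Real
open Finset Complex Polynomial CongruenceSubgroup
open Literature.NumberTheory.EllipticCurves.ModularForms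

namespace Literature.NumberTheory.LFunctions

namespace KMV2000

/-- **Good mass from the two displays at `Q = 1`, one profile** (pointwise core of `goodMass_lower_of_momentAsymptotics`):
at prime level `q`, weight `2`, let `P` be any real profile and `Δ > 0`, and suppose the two KMV displays hold AT `Q = 1` for this `P`
and this length — `L^h(P,1)(q̂^Δ) = ζ(2)√q̂/(Δ log q̂)·(lin + t₁) + O(√q̂ log⁻² q̂)` and
`Q^h(P,1)(q̂^Δ) = 2ζ(2)² q̂/(Δ² log² q̂)·(second + t₂) + O(q̂ log⁻³ q̂)` eventually in `q` (off the levels with `q̂^Δ ∈ ℕ`) — with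
`c₁ = lin + t₁ ≠ 0`, `c₂ = second + t₂ > 0`, the side condition `q̂^Δ ∉ ℕ` eventually and a mollifier-norm bound
`Σʰ‖M_P‖² ≤ C log q̂`. Then under Lapid–Rallis non-negativity, for every `ε > 0` and all large primes `q` with harmonic mass `≤ 2`:
`Σʰ_{w_f = 1, L(½,f) ≥ (log q)⁻²} 1 ≥ c₁²/(2c₂) − ε`. [cite: KowalskiMichelVanderKam2000, Thm. 6.1 (32) and §6 p. 19]
[cite: IwaniecConversations2006, §7 (7.5)] -/
theorem goodMass_lower_of_displaysAtOne
    (hLR : IwaniecSarnak.lapidRallis2003_theorem1_gl2Twist)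
    {P : ℝ[X]} {Δ t₁ t₂ : ℝ}
    (hH : ∃ C : ℝ, ∃ q₀ : ℕ, ∀ (q : ℕ) [NeZero q], q.Prime → q₀ ≤ q →
      (∀ n : ℕ, (n : ℝ) ≠ qhat q ^ Δ) →
        ‖LhPQ q P 1 (qhat q ^ Δ) -
            ((riemannZeta 2 * ((Real.sqrt (qhat q) / (Δ * Real.log (qhat q)) : ℝ) : ℂ)) *
              ((KMV2000.linForm Δ P 1 + t₁ : ℝ) : ℂ))‖ ≤
          C * Real.sqrt (qhat q) * (Real.log (qhat q))⁻¹ ^ 2 ∧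
        ‖QhPQ q P 1 (qhat q ^ Δ) -
            ((2 * riemannZeta 2 ^ 2 * ((qhat q / (Δ ^ 2 * Real.log (qhat q) ^ 2) : ℝ) : ℂ)) *
              ((KMV2000.secondMomentForm Δ P 1 + t₂ : ℝ) : ℂ))‖ ≤
          C * qhat q * (Real.log (qhat q))⁻¹ ^ 3)
    (hΔ : 0 < Δ)
    (hgen : ∃ q₁ : ℕ, ∀ q : ℕ, q.Prime → q₁ ≤ q → ∀ n : ℕ, (n : ℝ) ≠ qhat q ^ Δ)
    (hnorm : ∃ C : ℝ, ∃ q₁ : ℕ, ∀ (q : ℕ) [NeZero q], q.Prime → q₁ ≤ q →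
      IwaniecSarnak.harmonicSum q 2 (fun f ↦ ‖mollifierP q P (qhat q ^ Δ) f‖ ^ 2) ≤
        C * Real.log (qhat q))
    (hc₁ : linForm Δ P 1 + t₁ ≠ 0) (hc₂ : 0 < secondMomentForm Δ P 1 + t₂)
    {ε : ℝ} (hε : 0 < ε) :
    ∃ q₀ : ℕ, ∀ (q : ℕ) [NeZero q], q.Prime → q₀ ≤ q →
      IwaniecSarnak.harmonicSum q 2 (fun _ ↦ (1 : ℝ)) ≤ 2 →
      (linForm Δ P 1 + t₁) ^ 2 / (2 * (secondMomentForm Δ P 1 + t₂)) - ε ≤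
        IwaniecSarnak.harmonicSum q 2 (fun f ↦
          if IwaniecSarnak.rootNumber f = 1 ∧
            (Real.log q)⁻¹ ^ 2 ≤ (IwaniecSarnak.centralValue f).re then 1 else 0) := by
  -- constants
  set c₁ : ℝ := linForm Δ P 1 + t₁ with hc₁_def
  set c₂ : ℝ := secondMomentForm Δ P 1 + t₂ with hc₂_def
  set α : ℝ := Real.pi ^ 2 / 6 with hα_def
  have hα : 0 < α := by positivity
  have hζ : riemannZeta 2 = (α : ℂ) := by rw [riemannZeta_two, hα_def]; push_cast; ring
  obtain ⟨C, q₀, H⟩ := hH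
  obtain ⟨q₁, Hgen⟩ := hgen
  obtain ⟨CM, q₂, Hnorm⟩ := hnorm
  set K : ℝ := Real.sqrt 2 * Real.sqrt (max CM 0) with hK_def
  obtain ⟨x₀, hx₀1, Hcore⟩ := ThresholdCS.eventual_ratio_lower_bound C C K hα hc₁ hc₂ hΔ hε
  -- the level threshold
  set Nq : ℕ := ⌈(2 * Real.pi * Real.exp x₀) ^ 2⌉₊ with hNq_def
  refine ⟨max (max (max q₀ q₁) (max q₂ 40)) Nq, fun q _ hq hqge hW ↦ ?_⟩
  have hA : max (max q₀ q₁) (max q₂ 40) ≤ q := le_trans (le_max_left _ _) hqge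
  have hq₀ : q₀ ≤ q := le_trans (le_trans (le_max_left _ _) (le_max_left _ _)) hA
  have hq₁ : q₁ ≤ q := le_trans (le_trans (le_max_right _ _) (le_max_left _ _)) hA
  have hq₂ : q₂ ≤ q := le_trans (le_trans (le_max_left _ _) (le_max_right _ _)) hA
  have h40 : 40 ≤ q := le_trans (le_trans (le_max_right _ _) (le_max_right _ _)) hA
  have hNq : Nq ≤ q := le_trans (le_max_right _ _) hqge
  have hq1 : 1 ≤ q := le_trans (by norm_num) h40
  have hq2 : 2 ≤ q := le_trans (by norm_num) h40
  have hqhat1 : 1 < qhat q := one_lt_qhat h40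
  have hqhat0 : 0 < qhat q := lt_trans one_pos hqhat1
  -- the printed inputs at this level
  have hMint : ∀ n : ℕ, (n : ℝ) ≠ qhat q ^ Δ := Hgen q hq hq₁
  obtain ⟨h1st, h2nd⟩ := H q hq hq₀ hMint
  have hNsq := Hnorm q hq hq₂
  rw [LhPQ_one_eq_sum, hζ] at h1st
  rw [QhPQ_one_eq_sum, hζ] at h2nd
  set M : ℝ := qhat q ^ Δ with hM_def
  set x : ℝ := Real.log (qhat q) with hx_def
  have hx0 : 0 < x := Real.log_pos hqhat1
  -- `x ≥ x₀`
  have hxge : x₀ ≤ x := by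
    have hqR : (2 * Real.pi * Real.exp x₀) ^ 2 ≤ (q : ℝ) :=
      le_trans (Nat.le_ceil _) (by exact_mod_cast hNq)
    have hsq : 2 * Real.pi * Real.exp x₀ ≤ Real.sqrt q :=
      (Real.le_sqrt (by positivity) (by positivity)).2 hqR
    have hqh : Real.exp x₀ ≤ qhat q := by
      unfold qhat
      rw [le_div_iff₀ (by positivity)]
      linarith
    calc x₀ = Real.log (Real.exp x₀) := (Real.log_exp x₀).symm
      _ ≤ x := Real.log_le_log (Real.exp_pos _) hqh
  have hx1 : 1 ≤ x := le_trans hx₀1 hxge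
  have hxlog : x ≤ Real.log q :=
    Real.log_le_log hqhat0 (qhat_le_self hq1)
  -- the finite family and the floor
  set sF := (finite_newforms0_holds q 2).toFinset with hsF_def
  have hw : ∀ f ∈ sF, 0 ≤ IwaniecSarnak.harmonicWeight f :=
    fun f _ ↦ IwaniecSarnak.harmonicWeight_nonneg le_rfl f
  set τ : ℝ := Real.sqrt (qhat q) * (Real.log q)⁻¹ ^ 2 with hτ_def
  have hτ : 0 ≤ τ := by positivity
  set S : ℂ := ∑ f ∈ sF, (IwaniecSarnak.harmonicWeight f : ℂ) * completedL q f (1 / 2) *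
    mollifierP q P M f with hS_def
  set Q2 : ℝ := ∑ f ∈ sF, IwaniecSarnak.harmonicWeight f *
    ‖completedL q f (1 / 2) * mollifierP q P M f‖ ^ 2 with hQ2_def
  set N₁ : ℝ := ∑ f ∈ sF, IwaniecSarnak.harmonicWeight f * ‖mollifierP q P M f‖ with hN₁_def
  set g : ℝ := ∑ f ∈ sF with τ ≤ ‖completedL q f (1 / 2)‖, IwaniecSarnak.harmonicWeight f
    with hg_def
  -- Cauchy–Schwarz with the floor
  have hCS : τ * N₁ ≤ ‖S‖ → (‖S‖ - τ * N₁) ^ 2 ≤ g * Q2 := fun hle ↦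
    ThresholdCS.floor_cauchySchwarz sF hw (fun f ↦ completedL q f (1 / 2))
      (fun f ↦ mollifierP q P M f) hτ hle
  -- first moment from below
  have hr₁ : 0 ≤ Real.sqrt (qhat q) / (Δ * x) := by positivity
  have hs : α * (Real.sqrt (qhat q) / (Δ * x)) * |c₁| - C * Real.sqrt (qhat q) * x⁻¹ ^ 2 ≤ ‖S‖ := by
    have hm₁ : ‖(α : ℂ) * ((Real.sqrt (qhat q) / (Δ * x) : ℝ) : ℂ) * ((c₁ : ℝ) : ℂ)‖ =
        α * (Real.sqrt (qhat q) / (Δ * x)) * |c₁| := by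
      rw [norm_mul, norm_mul, Complex.norm_real, Complex.norm_real, Complex.norm_real,
        Real.norm_eq_abs, Real.norm_eq_abs, Real.norm_eq_abs, abs_of_pos hα, abs_of_nonneg hr₁]
    have h := norm_sub_norm_le ((α : ℂ) * ((Real.sqrt (qhat q) / (Δ * x) : ℝ) : ℂ) * ((c₁ : ℝ) : ℂ)) S
    rw [hm₁, ← norm_sub_rev] at h
    linarith
  -- floor correction from above
  have ht : τ * N₁ ≤ Real.sqrt (qhat q) * x⁻¹ ^ 2 * (K * Real.sqrt x) := by
    have hτle : τ ≤ Real.sqrt (qhat q) * x⁻¹ ^ 2 := by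
      have h1 : (Real.log q)⁻¹ ≤ x⁻¹ := inv_anti₀ hx0 hxlog
      have h2 : (Real.log q)⁻¹ ^ 2 ≤ x⁻¹ ^ 2 :=
        pow_le_pow_left₀ (inv_nonneg.2 (le_trans hx0.le hxlog)) h1 2
      exact mul_le_mul_of_nonneg_left h2 (Real.sqrt_nonneg _)
    have hW' : ∑ f ∈ sF, IwaniecSarnak.harmonicWeight f ≤ 2 := by
      have e : IwaniecSarnak.harmonicSum q 2 (fun _ ↦ (1 : ℝ)) =
          ∑ f ∈ sF, IwaniecSarnak.harmonicWeight f := by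
        rw [harmonicSum_eq_sum']
        simp [hsF_def]
      linarith [e ▸ hW]
    have hNsq' : ∑ f ∈ sF, IwaniecSarnak.harmonicWeight f * ‖mollifierP q P M f‖ ^ 2 ≤
        max CM 0 * x := by
      rw [← harmonicSum_eq_sum']
      exact le_trans hNsq (mul_le_mul_of_nonneg_right (le_max_left _ _) hx0.le)
    have hN₁le : N₁ ≤ K * Real.sqrt x := by
      have h := ThresholdCS.sum_mul_norm_le_sqrt_mul_sqrt sF hw (fun f ↦ mollifierP q P M f)
      have h1 : Real.sqrt (∑ f ∈ sF, IwaniecSarnak.harmonicWeight f) ≤ Real.sqrt 2 :=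
        Real.sqrt_le_sqrt hW'
      have h2 : Real.sqrt (∑ f ∈ sF, IwaniecSarnak.harmonicWeight f * ‖mollifierP q P M f‖ ^ 2) ≤
          Real.sqrt (max CM 0) * Real.sqrt x := by
        rw [← Real.sqrt_mul (le_max_right _ _)]
        exact Real.sqrt_le_sqrt hNsq'
      calc N₁ ≤ Real.sqrt (∑ f ∈ sF, IwaniecSarnak.harmonicWeight f) *
            Real.sqrt (∑ f ∈ sF, IwaniecSarnak.harmonicWeight f * ‖mollifierP q P M f‖ ^ 2) := h
        _ ≤ Real.sqrt 2 * (Real.sqrt (max CM 0) * Real.sqrt x) :=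
            mul_le_mul h1 h2 (Real.sqrt_nonneg _) (Real.sqrt_nonneg _)
        _ = K * Real.sqrt x := by rw [hK_def]; ring
    have hN₁nn : 0 ≤ N₁ :=
      Finset.sum_nonneg fun f hf ↦ mul_nonneg (hw f hf) (norm_nonneg _)
    exact mul_le_mul hτle hN₁le hN₁nn (by positivity)
  -- second moment, two-sided
  have hQabs : |Q2 - 2 * α ^ 2 * (qhat q / (Δ ^ 2 * x ^ 2)) * c₂| ≤ C * qhat q * x⁻¹ ^ 3 := by
    have e : (2 * (α : ℂ) ^ 2 * ((qhat q / (Δ ^ 2 * x ^ 2) : ℝ) : ℂ)) * ((c₂ : ℝ) : ℂ) =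
        ((2 * α ^ 2 * (qhat q / (Δ ^ 2 * x ^ 2)) * c₂ : ℝ) : ℂ) := by push_cast; ring
    rw [e, ← Complex.ofReal_sub, Complex.norm_real, Real.norm_eq_abs] at h2nd
    exact h2nd
  have hQge : 2 * α ^ 2 * (qhat q / (Δ ^ 2 * x ^ 2)) * c₂ - C * qhat q * x⁻¹ ^ 3 ≤ Q2 := by
    linarith [(abs_le.1 hQabs).1]
  have hQle : Q2 ≤ 2 * α ^ 2 * (qhat q / (Δ ^ 2 * x ^ 2)) * c₂ + C * qhat q * x⁻¹ ^ 3 := by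
    linarith [(abs_le.1 hQabs).2]
  -- the scalar lemma
  have hcore := Hcore x hxge (qhat q) ‖S‖ (τ * N₁) Q2 g hqhat0 hs ht hQge hQle hCS
  -- the good set feeds (7.5)
  exact le_trans hcore (goodSet_mass_le_goodMass hLR hq2)

end KMV2000

namespace CentralValueFamilyHalfEdge

open Filter _root_.Topology
open Literature.NumberTheory.LFunctions.IwaniecSarnak

/-- **The two displays at `Q = 1` for ONE profile with Cauchy–Schwarz value `R > ¼` ⇒ E*-fam at prime level, weight `2`**
(pointwise core of `primeLevelFamilyTwo_EStarFam_of_momentAsymptotics_pb`, Petersson input in its printed range): displays at `Q = 1`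
for `(P, Δ)` with main terms `lin + t₁`, `second + t₂` + `q̂^Δ ∉ ℕ` eventually + the norm shape + non-negativity ⇒
`∃ p₁ > ½, primeLevelFamilyTwo.EStarFam p₁ 2` (`p₁ = R + ¼`). [cite: IwaniecConversations2006, §7 (7.5) and p. 97]
[cite: KowalskiMichelVanderKam2000, Thm. 6.1 and §6 p. 19] -/
theorem primeLevelFamilyTwo_EStarFam_of_displaysAtOne_pb
    (hP : KowalskiMichel2000.kowalskiMichel2000_peterssonBound)
    (hLR : lapidRallis2003_theorem1_gl2Twist)
    {P : ℝ[X]} {Δ t₁ t₂ : ℝ}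
    (hH : ∃ C : ℝ, ∃ q₀ : ℕ, ∀ (q : ℕ) [NeZero q], q.Prime → q₀ ≤ q →
      (∀ n : ℕ, (n : ℝ) ≠ KMV2000.qhat q ^ Δ) →
        ‖KMV2000.LhPQ q P 1 (KMV2000.qhat q ^ Δ) -
            ((riemannZeta 2 * ((Real.sqrt (KMV2000.qhat q) / (Δ * Real.log (KMV2000.qhat q)) : ℝ) : ℂ)) *
              ((KMV2000.linForm Δ P 1 + t₁ : ℝ) : ℂ))‖ ≤
          C * Real.sqrt (KMV2000.qhat q) * (Real.log (KMV2000.qhat q))⁻¹ ^ 2 ∧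
        ‖KMV2000.QhPQ q P 1 (KMV2000.qhat q ^ Δ) -
            ((2 * riemannZeta 2 ^ 2 * ((KMV2000.qhat q / (Δ ^ 2 * Real.log (KMV2000.qhat q) ^ 2) : ℝ) : ℂ)) *
              ((KMV2000.secondMomentForm Δ P 1 + t₂ : ℝ) : ℂ))‖ ≤
          C * KMV2000.qhat q * (Real.log (KMV2000.qhat q))⁻¹ ^ 3)
    (hΔ : 0 < Δ)
    (hgen : ∃ q₁ : ℕ, ∀ q : ℕ, q.Prime → q₁ ≤ q → ∀ n : ℕ, (n : ℝ) ≠ KMV2000.qhat q ^ Δ)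
    (hnorm : ∃ C : ℝ, ∃ q₁ : ℕ, ∀ (q : ℕ) [NeZero q], q.Prime → q₁ ≤ q →
      harmonicSum q 2 (fun f ↦ ‖KMV2000.mollifierP q P (KMV2000.qhat q ^ Δ) f‖ ^ 2) ≤
        C * Real.log (KMV2000.qhat q))
    (hc₂ : 0 < KMV2000.secondMomentForm Δ P 1 + t₂)
    (hR : 1 / 4 < (KMV2000.linForm Δ P 1 + t₁) ^ 2 /
      (2 * (KMV2000.secondMomentForm Δ P 1 + t₂))) :
    ∃ p₁ : ℝ, 1 / 2 < p₁ ∧ primeLevelFamilyTwo.EStarFam p₁ 2 := by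
  set c₁ : ℝ := KMV2000.linForm Δ P 1 + t₁ with hc₁_def
  set c₂ : ℝ := KMV2000.secondMomentForm Δ P 1 + t₂ with hc₂_def
  set R : ℝ := c₁ ^ 2 / (2 * c₂) with hR_def
  have hc₁ : c₁ ≠ 0 := by
    intro h
    rw [hR_def, h] at hR
    norm_num at hR
  set ε : ℝ := (4 * R - 1) / (8 * R + 10) with hε_def
  have hε : 0 < ε := div_pos (by linarith) (by linarith)
  have hε1 : ε ≤ 1 / 2 := by
    rw [hε_def, div_le_iff₀ (by linarith)]
    linarith
  obtain ⟨q₀, Hgood⟩ := KMV2000.goodMass_lower_of_displaysAtOne hLR hH hΔ hgen hnorm hc₁ hc₂ hε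
  obtain ⟨Ct, Ht⟩ := abs_totalMass_sub_one_le_pb hP
  obtain ⟨Ce, He⟩ := abs_two_mul_evenMass_sub_totalMass_le_pb hP
  -- the Petersson error terms are eventually `< ε`
  have hev : ∀ᶠ q : ℕ in atTop,
      Ct * (q : ℝ) ^ (-(3 / 2 : ℝ)) < ε ∧ Ce * (q : ℝ) ^ (-(1 / 4 : ℝ)) < ε := by
    have h1 : Tendsto (fun q : ℕ ↦ Ct * (q : ℝ) ^ (-(3 / 2 : ℝ))) atTop (𝓝 0) := by
      have h := ((tendsto_rpow_neg_atTop (by norm_num : (0 : ℝ) < 3 / 2)).comp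
        tendsto_natCast_atTop_atTop).const_mul Ct
      rw [mul_zero] at h
      exact h
    have h2 : Tendsto (fun q : ℕ ↦ Ce * (q : ℝ) ^ (-(1 / 4 : ℝ))) atTop (𝓝 0) := by
      have h := ((tendsto_rpow_neg_atTop (by norm_num : (0 : ℝ) < 1 / 4)).comp
        tendsto_natCast_atTop_atTop).const_mul Ce
      rw [mul_zero] at h
      exact h
    exact ((tendsto_order.1 h1).2 ε hε).and ((tendsto_order.1 h2).2 ε hε)
  obtain ⟨q₃, Hq₃⟩ := Filter.eventually_atTop.1 hev
  refine ⟨R + 1 / 4, by linarith, ((max q₀ q₃ : ℕ) : ℝ),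
    fun (N : ℕ+) (hadm : Squarefree (N : ℕ) ∧ (N : ℕ).Prime)
      (hsz : ((max q₀ q₃ : ℕ) : ℝ) ≤ ((N : ℕ) : ℝ)) ↦ ?_⟩
  have hN : max q₀ q₃ ≤ (N : ℕ) := by exact_mod_cast hsz
  have hNq₀ : q₀ ≤ (N : ℕ) := le_trans (le_max_left _ _) hN
  have hNq₃ : q₃ ≤ (N : ℕ) := le_trans (le_max_right _ _) hN
  obtain ⟨hW1, hE1⟩ := Hq₃ (N : ℕ) hNq₃
  have hprime : (N : ℕ).Prime := hadm.2
  have hWabs := Ht (N : ℕ) hprime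
  have hEabs := He (N : ℕ) hprime
  have hW2 : harmonicSum (N : ℕ) 2 (fun _ ↦ (1 : ℝ)) ≤ 2 := by
    have := (abs_le.1 hWabs).2
    linarith
  have hE : harmonicSum (N : ℕ) 2 (fun f ↦ if rootNumber f = 1 then (1 : ℝ) else 0) ≤
      1 / 2 + ε := by
    have h₁ := (abs_le.1 hEabs).2
    have h₂ := (abs_le.1 hWabs).2
    linarith
  have hgood := Hgood (N : ℕ) hprime hNq₀ hW2
  show (R + 1 / 4) * (iwaniecSarnakFamily 2).evenMass N ≤ (iwaniecSarnakFamily 2).goodMass 2 N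
  rw [evenMass_iwaniecSarnakFamily, goodMass_iwaniecSarnakFamily]
  have key : (R + 1 / 4) * (1 / 2 + ε) = R - ε := by
    rw [hε_def]
    field_simp
    ring
  calc (R + 1 / 4) * harmonicSum (N : ℕ) 2 (fun f ↦ if rootNumber f = 1 then (1 : ℝ) else 0)
      ≤ (R + 1 / 4) * (1 / 2 + ε) := mul_le_mul_of_nonneg_left hE (by linarith)
    _ = R - ε := key
    _ ≤ _ := hgood

end CentralValueFamilyHalfEdge

end Literature.NumberTheory.LFunctions

end
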